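import Literature.IUT.HodgeTheaters.ProfiniteCompletionAbelianSubgroups
import HarnessLib

/-!
# [IUTchI] Lemma 2.7 (v): the generic reduction to a "basis character", and the named statement
# modulo its orientable-surface-group residual

Mochizuki, *Inter-universal Teichmüller theory I*, kurims manuscript (May 2020), §2, Lemma 2.7 (v)
(statement p. 57, proof p. 59) [cite: Mochizuki2012, Lem 2.7(v) p.59] (D-0012 claim key, status disputed
— the content here is plain profinite group theory and takes no side).  Companion of
`ProfiniteCompletionAbelianSubgroups.lean` (the FREE case, abc-iut-L5-t17) written at the request of
abc-iut-L5-lead (ruling 2026-08-25T21:23:43Z): it isolates the part of that proof which holds for an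
ARBITRARY discrete group `G`, so that the orientable-surface-group half of the named statement
`FreeOrSurface.zHatQuotientNormallyTerminal` (abc-iut-L5-t1) is reduced to one explicit finite-level
residual.  PROOF-ONLY (no definitions).

* `exists_basisCharacter_of_ne_one` — **generic reduction** (any `G`): if `τ, k ∈ Ĝ` commute,
  `φ : Ĝ → ℤ̂` is continuous with `φ τ = 1 ∈ ℤ̂` (topological generator) and `φ k = 1` (trivial), and
  `k ≠ 1`, then for some prime `p` and some power `k^m` there are an open subgroup `U ∋ τ, k^m` (open in
  the strong form "contains a principal congruence subgroup") and a continuous homomorphism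
  `ψ : U → (ℤ/p)²` with `ψ τ = (1,0)`, `ψ k^m = (0,1)`.  This is the printed "there exists a closed
  [abelian] subgroup `T̂₁ ⊆ Z_Ĝ(T̂)` … [and] a continuous surjection `ℤ_l × ℤ_l ↠ T̂₁` whose kernel lies in
  `l · (ℤ_l × ℤ_l)`" (p. 59) in finite dress.
* `false_of_lift_pair` — the generic contradiction: such a `ψ`, restricted to any subgroup `V ∋ τ, κ`
  (`τ κ = κ τ`), cannot lift through a finite `B ↠ (ℤ/p)²` in which no lifts of the two basis vectors
  commute (e.g. `C_p ≀ C_p`, `wreath_not_commute` of `ProfiniteCompletionLifting.lean`, or an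
  extraspecial group).  This is where "the `l`-cohomological dimension of `T̂₁` is `1`" (p. 59) enters.
* `centralizer_le_of_zHat_of_noBasisCharacter`, `normalizer_eq_of_zHat_of_noBasisCharacter` — for ANY
  `G` satisfying the finite-level statement "NO BASIS CHARACTER" (spelled out inline: no open `U ⊆ Ĝ`
  carries a continuous `ψ : U → (ℤ/p)²` sending a COMMUTING pair to a basis), every subgroup `T̂ ⊆ Ĝ`
  on which a continuous `φ : Ĝ → ℤ̂` is bijective satisfies `Z_Ĝ(T̂) ⊆ T̂` and `N_Ĝ(T̂) = T̂`.
* `noBasisCharacter_of_isFreeGroup` — free groups satisfy it (the lifting lemma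
  `exists_lift_of_surjective`, Nielsen–Schreier; a second route to the free case).
* `FreeOrSurface.zHatQuotientNormallyTerminal_of_surface_noBasisCharacter` — **the named statement of
  Lemma 2.7 (v), for free AND orientable surface groups, MODULO the single residual** "orientable
  surface groups satisfy NO BASIS CHARACTER" (taken as an explicit hypothesis; it is the p. 59 sentence
  "since `T̂₁` is of infinite index in `Ĝ` … the `l`-cohomological dimension of `T̂₁` is `1`" for
  `G = π₁(Σ_g)`, whose elementary proof needs that open subgroups of `Ŝ_g` are completions of surface
  groups `S_{g'}` and that the extraspecial obstruction dies on an index-`p` subgroup — not in the tree;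
  campaign-L infrastructure, recorded honestly as a hypothesis, NOT as a cited fact).

Typed ≠ discharged: the last theorem is CONDITIONAL; the free half is unconditional
(`zHatQuotientNormallyTerminal_of_isFreeOfFiniteRank`, companion file).
-/

namespace Literature.IUT.HodgeTheaters

open CategoryTheory ProfiniteGrp ProfiniteGrp.ProfiniteCompletion Topology Multiplicative

universe u

namespace ProfiniteCompletion

variable {G : Type u} [Group G]

/-- **Generic reduction of Lemma 2.7 (v) to a basis character** (any discrete group `G`).  Let
`φ : Ĝ → ℤ̂` be continuous, `τ, k ∈ Ĝ` commuting with `φ τ` the topological generator `1 ∈ ℤ̂` and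
`φ k = 1`.  If `k ≠ 1`, then there are a prime `p`, an exponent `m`, a subgroup `U ⊆ Ĝ` containing a
principal congruence subgroup (so open) and `τ, k^m`, and a homomorphism `ψ : U → (ℤ/p)²` killing a
principal congruence subgroup (so continuous) with `ψ τ = (1,0)` and `ψ k^m = (0,1)` (written
multiplicatively).  Construction: a finite level `G/N₀` where a power `k^m` of `k` has prime order `p`;
`n = |G/N₀|`; `Ψ = (·|_{N₀}, φ mod n) : Ĝ → G/N₀ × ℤ/n`; `⟨Ψτ, Ψk^m⟩ ≅ ℤ/n × ℤ/p` with `p ∣ n`;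
`U = Ψ⁻¹⟨Ψτ, Ψk^m⟩`; `ψ` = reduction mod `p` of both exponents (p. 59: "`ℤ_l × ℤ_l ↠ T̂₁` whose kernel
lies in `l · (ℤ_l × ℤ_l)`"). [cite: Mochizuki2012, Lem 2.7(v) p.59] -/
theorem exists_basisCharacter_of_ne_one (φ : profiniteCompletion G →* ZHat)
    (hφ : Continuous φ) {τ k : profiniteCompletion G} (hc : τ * k = k * τ)
    (hτ : φ τ = toCompletion (Multiplicative ℤ) (ofAdd 1)) (hk : φ k = 1) (hk1 : k ≠ 1) :
    ∃ (p : ℕ) (_ : p.Prime) (m : ℕ) (U : Subgroup (profiniteCompletion G)) (hτU : τ ∈ U)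
      (hkU : k ^ m ∈ U) (ψ : U →* Multiplicative (ZMod p) × Multiplicative (ZMod p)),
      (∃ N₁ : FiniteIndexNormalSubgroup G, ∀ x : profiniteCompletion G, x.val N₁ = 1 → x ∈ U) ∧
      (∃ N₂ : FiniteIndexNormalSubgroup G,
        ∀ (x : profiniteCompletion G) (hx : x ∈ U), x.val N₂ = 1 → ψ ⟨x, hx⟩ = 1) ∧
      ψ ⟨τ, hτU⟩ = (ofAdd 1, 1) ∧ ψ ⟨k ^ m, hkU⟩ = (1, ofAdd 1) := by
  classical
  obtain ⟨N₀, hN₀⟩ := exists_val_ne_one hk1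
  -- the projection `π : Ĝ → G/N₀`
  let π : profiniteCompletion G →* G ⧸ N₀.toSubgroup :=
    MonoidHom.mk' (fun x => (x.val N₀ : G ⧸ N₀.toSubgroup)) fun _ _ => rfl
  have hπk : π k ≠ 1 := hN₀
  -- a prime `p` and a power `k₁` of `k` whose image has order `p`
  have hm0 : orderOf (π k) ≠ 0 := (orderOf_pos (π k)).ne'
  have hm1 : orderOf (π k) ≠ 1 := fun h => hπk (orderOf_eq_one_iff.mp h)
  obtain ⟨p, hpdef⟩ : ∃ p, p = (orderOf (π k)).minFac := ⟨_, rfl⟩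
  haveI hp : Fact p.Prime := ⟨hpdef ▸ Nat.minFac_prime hm1⟩
  have hpm : p ∣ orderOf (π k) := hpdef ▸ Nat.minFac_dvd _
  obtain ⟨k₁, hk₁def⟩ : ∃ k₁, k₁ = k ^ (orderOf (π k) / p) := ⟨_, rfl⟩
  have hk₁ord : orderOf (π k₁) = p := by
    rw [hk₁def, map_pow]
    exact orderOf_pow_orderOf_div hm0 hpm
  have hc₁ : τ * k₁ = k₁ * τ := by
    rw [hk₁def]
    exact (Commute.pow_right hc _).eq
  have hk₁φ : φ k₁ = 1 := by rw [hk₁def, map_pow, hk, one_pow]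
  -- `n = |G/N₀|`, so `p ∣ n` and `π(x)^n = 1`
  obtain ⟨n, hndef⟩ : ∃ n, n = Nat.card (G ⧸ N₀.toSubgroup) := ⟨_, rfl⟩
  haveI : NeZero n := ⟨hndef ▸ Nat.card_pos.ne'⟩
  have hpn : p ∣ n := by rw [← hk₁ord, hndef]; exact orderOf_dvd_natCard (π k₁)
  have hπn : ∀ x, (π x) ^ n = 1 := fun x => by rw [hndef]; exact pow_card_eq_one'
  -- reduction `ρ : ℤ̂ → ℤ/n`
  obtain ⟨ρ, hρη, -, hρc⟩ :=
    exists_lift_of_finite (G := Multiplicative ℤ) ((Int.castAddHom (ZMod n)).toMultiplicative)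
  have hρc' : Continuous ρ := hρc
  -- `Ψ = (π, ρ ∘ φ)`
  let Ψ : profiniteCompletion G →* (G ⧸ N₀.toSubgroup) × Multiplicative (ZMod n) :=
    π.prod (ρ.comp φ)
  have hΨτ : Ψ τ = (π τ, ofAdd 1) := by
    change (π τ, ρ (φ τ)) = _
    rw [hτ, hρη]
    simp
  have hΨk : Ψ k₁ = (π k₁, 1) := by
    change (π k₁, ρ (φ k₁)) = _
    rw [hk₁φ, map_one]
  -- a level `N` with `{x | x.val N = 1} ⊆ Ker Ψ`
  obtain ⟨N₃, hN₃⟩ : ∃ N₃ : FiniteIndexNormalSubgroup G,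
      ∀ x : profiniteCompletion G, x.val N₃ = 1 → ρ (φ x) = 1 := by
    have ho : IsOpen ((fun x => ρ (φ x)) ⁻¹' {1}) := (isOpen_discrete _).preimage (hρc'.comp hφ)
    have h1 : (1 : profiniteCompletion G) ∈ (fun x => ρ (φ x)) ⁻¹' {1} := by
      rw [Set.mem_preimage, map_one, map_one]
      exact Set.mem_singleton 1
    exact exists_val_eq_one_subset_of_isOpen ho h1
  let N : FiniteIndexNormalSubgroup G := N₀ ⊓ N₃
  have hNΨ : ∀ x : profiniteCompletion G, x.val N = 1 → Ψ x = 1 := by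
    intro x hx
    have h0 : x.val N₀ = 1 := val_eq_one_of_le x inf_le_left hx
    have h3 : ρ (φ x) = 1 := hN₃ x (val_eq_one_of_le x inf_le_right hx)
    exact Prod.ext h0 h3
  -- the abelian image `C = ⟨Ψ τ, Ψ k₁⟩` as the range of `gC : ℤ × ℤ → G/N₀ × ℤ/n`
  have hcomm : Commute (Ψ τ) (Ψ k₁) := by
    change Ψ τ * Ψ k₁ = Ψ k₁ * Ψ τ
    rw [← map_mul, hc₁, map_mul]
  let gC : Multiplicative ℤ × Multiplicative ℤ →* (G ⧸ N₀.toSubgroup) × Multiplicative (ZMod n) :=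
    MonoidHom.noncommCoprod (zpowersHom _ (Ψ τ)) (zpowersHom _ (Ψ k₁))
      fun a b => (hcomm.zpow_left a.toAdd).zpow_right b.toAdd
  have hgC : ∀ a b : Multiplicative ℤ, gC (a, b) = Ψ τ ^ a.toAdd * Ψ k₁ ^ b.toAdd := fun a b => rfl
  let C := gC.range
  let U : Subgroup (profiniteCompletion G) := C.comap Ψ
  have hτU : τ ∈ U := ⟨(ofAdd 1, 1), by rw [hgC]; simp⟩
  have hkU : k₁ ∈ U := ⟨(1, ofAdd 1), by rw [hgC]; simp⟩
  -- the kernel of `gC` dies under reduction mod `p`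
  let red : Multiplicative ℤ →* Multiplicative (ZMod p) := (Int.castAddHom (ZMod p)).toMultiplicative
  have hred : ∀ a : Multiplicative ℤ, (p : ℤ) ∣ a.toAdd → red a = 1 := by
    intro a ha
    change ofAdd ((a.toAdd : ZMod p)) = 1
    rw [(ZMod.intCast_zmod_eq_zero_iff_dvd a.toAdd p).mpr ha, ofAdd_zero]
  let βt : Multiplicative ℤ × Multiplicative ℤ →* Multiplicative (ZMod p) × Multiplicative (ZMod p) :=
    red.prodMap red
  have hτ2 : (Ψ τ).2 = ofAdd 1 := by rw [hΨτ]
  have hk2 : (Ψ k₁).2 = 1 := by rw [hΨk]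
  have hker : gC.rangeRestrict.ker ≤ βt.ker := by
    rw [MonoidHom.ker_rangeRestrict]
    rintro ⟨a, b⟩ hab
    rw [MonoidHom.mem_ker, hgC] at hab
    -- second coordinate: `n ∣ a`
    have h2 := congrArg (MonoidHom.snd (G ⧸ N₀.toSubgroup) (Multiplicative (ZMod n))) hab
    rw [map_mul, map_zpow, map_zpow, map_one, MonoidHom.coe_snd, hτ2, hk2, one_zpow, mul_one,
      ← ofAdd_zsmul, zsmul_one, ofAdd_eq_one, ZMod.intCast_zmod_eq_zero_iff_dvd] at h2
    -- first coordinate: `p ∣ b`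
    have h1 := congrArg (MonoidHom.fst (G ⧸ N₀.toSubgroup) (Multiplicative (ZMod n))) hab
    rw [map_mul, map_zpow, map_zpow, map_one, MonoidHom.coe_fst] at h1
    change π τ ^ a.toAdd * π k₁ ^ b.toAdd = 1 at h1
    obtain ⟨c, hc⟩ := h2
    rw [hc, zpow_mul, zpow_natCast, hπn, one_zpow, one_mul, ← orderOf_dvd_iff_zpow_eq_one,
      hk₁ord] at h1
    have ha : (p : ℤ) ∣ a.toAdd := (Int.natCast_dvd_natCast.mpr hpn).trans ⟨c, hc⟩
    rw [MonoidHom.mem_ker]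
    exact Prod.ext (hred a ha) (hred b h1)
  let β : C →* Multiplicative (ZMod p) × Multiplicative (ZMod p) :=
    gC.rangeRestrict.liftOfSurjective gC.rangeRestrict_surjective ⟨βt, hker⟩
  have hβ : ∀ z, β (gC.rangeRestrict z) = βt z := fun z =>
    MonoidHom.liftOfRightInverse_comp_apply _ _ _ _ z
  -- `ψ : U → (ℤ/p)²`, `τ ↦ (1, 0)`, `k₁ ↦ (0, 1)` (written multiplicatively)
  let ΨU : U →* C := (Ψ.comp U.subtype).codRestrict C fun x => x.2
  let ψ : U →* Multiplicative (ZMod p) × Multiplicative (ZMod p) := β.comp ΨU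
  have hΨU : ∀ (x : profiniteCompletion G) (hx : x ∈ U) (z : Multiplicative ℤ × Multiplicative ℤ),
      gC z = Ψ x → ΨU ⟨x, hx⟩ = gC.rangeRestrict z := fun x hx z hz => Subtype.ext hz.symm
  have hred1 : red (ofAdd 1) = ofAdd 1 := by
    change ofAdd (((1 : ℤ) : ZMod p)) = ofAdd 1
    rw [Int.cast_one]
  have hψτ : ψ ⟨τ, hτU⟩ = (ofAdd 1, 1) := by
    change β (ΨU ⟨τ, hτU⟩) = _
    rw [hΨU τ hτU (ofAdd 1, 1) (by rw [hgC]; simp), hβ]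
    change (red (ofAdd 1), red 1) = _
    rw [map_one red, hred1]
  have hψk : ψ ⟨k₁, hkU⟩ = (1, ofAdd 1) := by
    change β (ΨU ⟨k₁, hkU⟩) = _
    rw [hΨU k₁ hkU (1, ofAdd 1) (by rw [hgC]; simp), hβ]
    change (red 1, red (ofAdd 1)) = _
    rw [map_one red, hred1]
  -- hypotheses of the lifting lemma: `{x | x.val N = 1} ⊆ U ∩ Ker ψ`
  have hU1 : ∃ N₁ : FiniteIndexNormalSubgroup G,
      ∀ x : profiniteCompletion G, x.val N₁ = 1 → x ∈ U :=
    ⟨N, fun x hx => by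
      change Ψ x ∈ C
      rw [hNΨ x hx]
      exact C.one_mem⟩
  have hψ1 : ∃ N₂ : FiniteIndexNormalSubgroup G,
      ∀ (x : profiniteCompletion G) (hx : x ∈ U), x.val N₂ = 1 → ψ ⟨x, hx⟩ = 1 :=
    ⟨N, fun x hx hxN => by
      have h1 : ΨU ⟨x, hx⟩ = 1 := Subtype.ext (hNΨ x hxN)
      change β (ΨU ⟨x, hx⟩) = 1
      rw [h1, map_one]⟩
  -- assemble
  refine ⟨p, hp.out, orderOf (π k) / p, U, hτU, hk₁def ▸ hkU, ψ, hU1, hψ1, hψτ, ?_⟩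
  have e : (⟨k ^ (orderOf (π k) / p), hk₁def ▸ hkU⟩ : U) = ⟨k₁, hkU⟩ := Subtype.ext hk₁def.symm
  rw [e]
  exact hψk

/-- **The generic contradiction.**  A homomorphism `ψ : V → (ℤ/p)²` on a subgroup `V ⊆ Ĝ` sending two
COMMUTING elements `τ, κ ∈ V` to the basis `(1,0), (0,1)` cannot lift through a homomorphism
`α : B → (ℤ/p)²` from a group in which no lift of `(1,0)` commutes with a lift of `(0,1)` (e.g.
`C_p ≀ C_p`, `wreath_not_commute`; or an extraspecial `p`-group).  This packages the step "the
`l`-cohomological dimension of `T̂₁` is `≥ 2` … [but] is `1`, a contradiction" (p. 59) at the finite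
level, for whichever lifting statement is available for `G`. [cite: Mochizuki2012, Lem 2.7(v) p.59] -/
theorem false_of_lift_pair {p : ℕ} {V : Subgroup (profiniteCompletion G)} {τ κ : profiniteCompletion G}
    (hτ : τ ∈ V) (hκ : κ ∈ V) (hc : τ * κ = κ * τ)
    (ψ : V →* Multiplicative (ZMod p) × Multiplicative (ZMod p))
    (hψτ : ψ ⟨τ, hτ⟩ = (ofAdd 1, 1)) (hψκ : ψ ⟨κ, hκ⟩ = (1, ofAdd 1))
    {B : Type*} [Group B] (α : B →* Multiplicative (ZMod p) × Multiplicative (ZMod p))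
    (hB : ∀ x y : B, α x = (ofAdd 1, 1) → α y = (1, ofAdd 1) → x * y ≠ y * x)
    (θ : V →* B) (hθ : ∀ x : V, α (θ x) = ψ x) : False := by
  refine hB (θ ⟨τ, hτ⟩) (θ ⟨κ, hκ⟩) (by rw [hθ, hψτ]) (by rw [hθ, hψκ]) ?_
  rw [← map_mul, ← map_mul]
  exact congrArg θ (Subtype.ext hc)

/-- **`Z_Ĝ(T̂) ⊆ T̂` for any `G` with NO BASIS CHARACTER.**  Suppose `G` satisfies the finite-level
statement spelled out as the hypothesis `hN`: no subgroup `U ⊆ Ĝ` containing a principal congruence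
subgroup carries a homomorphism `ψ : U → (ℤ/p)²` (`p` prime) killing a principal congruence subgroup and
sending a COMMUTING pair `τ, κ ∈ U` to `(1,0), (0,1)`.  Then for every continuous `φ : Ĝ → ℤ̂` and every
subgroup `T̂ ⊆ Ĝ` on which `φ` is bijective, the centralizer of `T̂` lies in `T̂` (argument of
`centralizer_le_of_zHat`, with `exists_basisCharacter_of_ne_one` in place of the free-group lifting).
[cite: Mochizuki2012, Lem 2.7(v) p.59] -/
theorem centralizer_le_of_zHat_of_noBasisCharacter
    (hN : ∀ (p : ℕ), p.Prime → ∀ (U : Subgroup (profiniteCompletion G)),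
      (∃ N₁ : FiniteIndexNormalSubgroup G, ∀ x : profiniteCompletion G, x.val N₁ = 1 → x ∈ U) →
      ∀ (ψ : U →* Multiplicative (ZMod p) × Multiplicative (ZMod p)),
      (∃ N₂ : FiniteIndexNormalSubgroup G,
        ∀ (x : profiniteCompletion G) (hx : x ∈ U), x.val N₂ = 1 → ψ ⟨x, hx⟩ = 1) →
      ∀ (τ κ : profiniteCompletion G) (hτ : τ ∈ U) (hκ : κ ∈ U), τ * κ = κ * τ →
      ψ ⟨τ, hτ⟩ = (ofAdd 1, 1) → ψ ⟨κ, hκ⟩ = (1, ofAdd 1) → False)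
    (T : Subgroup (profiniteCompletion G)) (φ : profiniteCompletion G →* ZHat) (hφ : Continuous φ)
    (hT : Function.Bijective (φ.comp T.subtype)) :
    Subgroup.centralizer (T : Set (profiniteCompletion G)) ≤ T := by
  intro z hz
  rw [Subgroup.mem_centralizer_iff] at hz
  -- `T̂` is abelian
  have hTab : ∀ a ∈ T, ∀ b ∈ T, a * b = b * a := fun a ha b hb => by
    have h := hT.1 (a₁ := ⟨a, ha⟩ * ⟨b, hb⟩) (a₂ := ⟨b, hb⟩ * ⟨a, ha⟩)
      (by rw [map_mul, map_mul]; exact ZHat.mul_comm _ _)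
    exact congrArg Subtype.val h
  obtain ⟨⟨t, ht⟩, htz⟩ := hT.2 (φ z)
  obtain ⟨⟨τ, hτ⟩, hτ1⟩ := hT.2 (toCompletion (Multiplicative ℤ) (ofAdd 1))
  change φ t = φ z at htz
  change φ τ = _ at hτ1
  have hk1 : φ (t⁻¹ * z) = 1 := by rw [map_mul, map_inv, htz, inv_mul_cancel]
  have hc : τ * (t⁻¹ * z) = t⁻¹ * z * τ := by
    have h1 : τ * t⁻¹ = t⁻¹ * τ := hTab τ hτ t⁻¹ (T.inv_mem ht)
    have h2 : τ * z = z * τ := hz τ hτ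
    calc τ * (t⁻¹ * z) = τ * t⁻¹ * z := (mul_assoc _ _ _).symm
      _ = t⁻¹ * (τ * z) := by rw [h1, mul_assoc]
      _ = t⁻¹ * z * τ := by rw [h2, mul_assoc]
  by_cases hk : t⁻¹ * z = 1
  · rw [← inv_mul_eq_one.mp hk]
    exact ht
  · exfalso
    obtain ⟨p, hp, m, U, hτU, hkU, ψ, hU1, hψ1, hψτ, hψk⟩ :=
      exists_basisCharacter_of_ne_one φ hφ hc hτ1 hk1 hk
    exact hN p hp U hU1 ψ hψ1 τ ((t⁻¹ * z) ^ m) hτU hkU (Commute.pow_right hc m).eq hψτ hψk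

/-- `N_Ĝ(T̂) = T̂` for any `G` with NO BASIS CHARACTER (`centralizer_le_of_zHat_of_noBasisCharacter` +
abc-iut-L5-t9's `normalizer_le_centralizer_of_injOn`). [cite: Mochizuki2012, Lem 2.7(v) p.59] -/
theorem normalizer_eq_of_zHat_of_noBasisCharacter
    (hN : ∀ (p : ℕ), p.Prime → ∀ (U : Subgroup (profiniteCompletion G)),
      (∃ N₁ : FiniteIndexNormalSubgroup G, ∀ x : profiniteCompletion G, x.val N₁ = 1 → x ∈ U) →
      ∀ (ψ : U →* Multiplicative (ZMod p) × Multiplicative (ZMod p)),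
      (∃ N₂ : FiniteIndexNormalSubgroup G,
        ∀ (x : profiniteCompletion G) (hx : x ∈ U), x.val N₂ = 1 → ψ ⟨x, hx⟩ = 1) →
      ∀ (τ κ : profiniteCompletion G) (hτ : τ ∈ U) (hκ : κ ∈ U), τ * κ = κ * τ →
      ψ ⟨τ, hτ⟩ = (ofAdd 1, 1) → ψ ⟨κ, hκ⟩ = (1, ofAdd 1) → False)
    (T : Subgroup (profiniteCompletion G)) (φ : profiniteCompletion G →* ZHat) (hφ : Continuous φ)
    (hT : Function.Bijective (φ.comp T.subtype)) :
    Subgroup.normalizer (T : Set (profiniteCompletion G)) = T := by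
  have hinj : Set.InjOn φ T := by
    intro a ha b hb hab
    have := hT.1 (a₁ := ⟨a, ha⟩) (a₂ := ⟨b, hb⟩) (by simpa using hab)
    exact congrArg Subtype.val this
  apply le_antisymm
  · exact (normalizer_le_centralizer_of_injOn ZHat.mul_comm φ T hinj).trans
      (centralizer_le_of_zHat_of_noBasisCharacter hN T φ hφ hT)
  · exact Subgroup.le_normalizer

/-- **Free groups have NO BASIS CHARACTER**: by the lifting lemma (`exists_lift_of_surjective`,
Nielsen–Schreier) the character lifts to `C_p ≀ C_p` on all of `U`, contradicting `false_of_lift_pair`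
with `wreath_not_commute`.  (A second route to the free case of Lemma 2.7 (v).) [cite: Mochizuki2012, Lem 2.7(v) p.59] -/
theorem noBasisCharacter_of_isFreeGroup [IsFreeGroup G] :
    ∀ (p : ℕ), p.Prime → ∀ (U : Subgroup (profiniteCompletion G)),
      (∃ N₁ : FiniteIndexNormalSubgroup G, ∀ x : profiniteCompletion G, x.val N₁ = 1 → x ∈ U) →
      ∀ (ψ : U →* Multiplicative (ZMod p) × Multiplicative (ZMod p)),
      (∃ N₂ : FiniteIndexNormalSubgroup G,
        ∀ (x : profiniteCompletion G) (hx : x ∈ U), x.val N₂ = 1 → ψ ⟨x, hx⟩ = 1) →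
      ∀ (τ κ : profiniteCompletion G) (hτ : τ ∈ U) (hκ : κ ∈ U), τ * κ = κ * τ →
      ψ ⟨τ, hτ⟩ = (ofAdd 1, 1) → ψ ⟨κ, hκ⟩ = (1, ofAdd 1) → False := by
  intro p hp U hU1 ψ hψ1 τ κ hτ hκ hc hψτ hψκ
  haveI : Fact p.Prime := ⟨hp⟩
  obtain ⟨σ, hσ⟩ := exists_wreath_prod_hom p
  obtain ⟨θ, hθ⟩ := exists_lift_of_surjective U hU1 (RegularWreathProduct.rightHom.prod σ)
    (wreath_pair_surjective p σ hσ) ψ hψ1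
  refine false_of_lift_pair hτ hκ hc ψ hψτ hψκ (RegularWreathProduct.rightHom.prod σ) ?_ θ hθ
  intro x y hx hy
  rw [MonoidHom.prod_apply, Prod.mk.injEq] at hx hy
  exact wreath_not_commute p x y hx.1 hy.1 ((hσ y).symm.trans hy.2)

end ProfiniteCompletion

/-! ### The named statement modulo the orientable-surface-group residual -/

namespace FreeOrSurface

/-- **Lemma 2.7 (v)** (the named statement `FreeOrSurface.zHatQuotientNormallyTerminal`, for `G` free of
finite rank OR an orientable surface group) **modulo ONE residual**: that orientable surface groups have
NO BASIS CHARACTER (hypothesis `hS`, spelled out; for `G = π₁(Σ_g)` this is the p. 59 sentence "since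
`T̂₁` is of infinite index in `Ĝ` … the `l`-cohomological dimension of `T̂₁` is `1`", i.e. an open
subgroup of `Ŝ_g` cannot carry a continuous `(ℤ/p)²`-character taking a commuting pair to a basis — NOT
proved here and NOT a cited fact: it needs that open subgroups of `Ŝ_g` are completions of surface groups
and that the extraspecial obstruction dies on an index-`p` subgroup).  The free branch is unconditional
(`ProfiniteCompletion.normalizer_eq_of_zHat_of_isFreeGroup`, companion file).  CONDITIONAL theorem;
typed ≠ discharged. [cite: Mochizuki2012, Lem 2.7(v) p.59] -/
theorem zHatQuotientNormallyTerminal_of_surface_noBasisCharacter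
    (hS : ∀ (G : Type u) [Group G], IsOrientableSurfaceGroup G →
      ∀ (p : ℕ), p.Prime → ∀ (U : Subgroup (profiniteCompletion G)),
      (∃ N₁ : FiniteIndexNormalSubgroup G, ∀ x : profiniteCompletion G, x.val N₁ = 1 → x ∈ U) →
      ∀ (ψ : U →* Multiplicative (ZMod p) × Multiplicative (ZMod p)),
      (∃ N₂ : FiniteIndexNormalSubgroup G,
        ∀ (x : profiniteCompletion G) (hx : x ∈ U), x.val N₂ = 1 → ψ ⟨x, hx⟩ = 1) →
      ∀ (τ κ : profiniteCompletion G) (hτ : τ ∈ U) (hκ : κ ∈ U), τ * κ = κ * τ →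
      ψ ⟨τ, hτ⟩ = (ofAdd 1, 1) → ψ ⟨κ, hκ⟩ = (1, ofAdd 1) → False) :
    zHatQuotientNormallyTerminal.{u} := by
  intro G _ hG T _ hφ
  obtain ⟨φ, hφc, -, hφb⟩ := hφ
  rcases hG with hfree | hsurf
  · obtain ⟨n, ⟨e⟩⟩ := hfree
    haveI : IsFreeGroup G := IsFreeGroup.ofMulEquiv e.symm
    exact normalizer_eq_of_zHat_of_isFreeGroup G T φ hφc hφb
  · exact ProfiniteCompletion.normalizer_eq_of_zHat_of_noBasisCharacter (hS G hsurf) T φ hφc hφb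

end FreeOrSurface

end Literature.IUT.HodgeTheaters
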